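import Literature.IUT.HodgeArakelov.TemperedThetaMonoidsDef38DivisorProofs
import HarnessLib

/-!
# [IUTchII] Definition 3.8 (ii) «… to every object of `B^temp(G_v(−))⁰` a monoid isomorphic to `ℕ`» — proof companion:
# invariants of a split monoid under automorphisms fixing the generator

S. Mochizuki, *Inter-universal Teichmüller theory II*, §3, kurims Dec-2020 manuscript, Definition 3.8 (ii) p. 113 l. 62 – p. 114
l. 1: «Each of the monoids equipped with a topological group action `G_v(M^Θ_*▶) ↷ Ψ^ι_env(M^Θ_*)`; … `G_v(M^Θ_*)_⟨F_l^⋇⟩ ↷ Ψ_{F_ξ}(†F_v)`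
… gives rise to a `p_v`-adic Frobenioid of monoid type `ℤ` [cf. [FrdII], Example 1.1, (ii)] … whose divisor monoid associates to every
object of `B^temp(G_v(−))⁰` [where “(−)” is `M^Θ_*▶` or `M^Θ_*`] a monoid isomorphic to `ℕ`» [cite: Mochizuki2012, Def 3.8 (ii) p.113].
Claim key DISPUTED (D-0012): nothing disputed is asserted. PROOF-ONLY companion (abc-iut cell, layer L6, seat abc-iut-w4-d019 gen 4,
row «IUTchII-COR37-DEF38-COVERAGE»; node **IUTchII:Def3.8(ii)**): NO `def`, NO `structure`, NO `instance`, NO new `Prop` fact.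

Sequel to `TemperedThetaMonoidsDef38DivisorProofs.lean` (p446426: the divisor monoid of a split monoid `U · θ^ℕ` is `(ℕ, +)`).
In [FrdII] Ex 1.1 (ii) the divisor monoid AT AN OBJECT of the base — a connected tempered covering, i.e. an open subgroup of
`G_v(−)` up to conjugacy — is computed on the INVARIANTS of the monoid under that open subgroup.  Here, for any family `Φ` of
automorphisms of the ambient module FIXING the generator `θ` (print: the value-profile `ξ = (q_v^{t²})_t` and the theta class are
fixed by the relevant Galois / decomposition-group actions — the `hfix`-type inputs of Cor 3.5 (ii), abc-iut-w4-d004's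
`BadPrimeGaussianMonoidsCohomologyModelProofs*`, consumed BY NAME), the `Φ`-invariants of `U · θ^ℕ` ARE the split monoid
`U^Φ · θ^ℕ` over the fixed subgroup `U^Φ = U ⊓ ⨅_{φ ∈ Φ} Fix(φ)` (`mem_splitMonoid_and_fixed_iff`), `θ` stays of infinite order
modulo `U^Φ`, and hence the divisor monoid at that object is again `(ℕ, +)` generated by the class of `θ`
(`exists_associates_fixed_splitMonoid_equiv_nat`).  HONEST LIMITS: the packaging of these invariants into abc-iut-L1's
`PadicFrd.Datum` over the base `B^temp(G_v(−))⁰` (the residual R-Def38-a of the row's coverage line = MERGE-MAP §1 l.122) is NOT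
done here; when `θ` is fixed only up to units (a cocycle), the invariants need not contain a generator — that case is not claimed.
no side taken on [IUTchIII] Cor 3.12; typed ≠ proved.
-/

namespace Literature.IUT.HodgeArakelov

namespace TemperedThetaMonoids

open BadPrimeGaussianMonoids

universe u v

section Invariants

variable {H : Type u} [CommGroup H] (U : Subgroup H) (θ : H) (Φ : Set (H ≃* H))

/-- **IUTchII:Def3.8(ii)** (kurims p.113 l.76 – p.114 l.1 «to every object of `B^temp(G_v(−))⁰`»), invariants of a split monoid:
if every automorphism of the family `Φ` fixes the generator `θ`, an element of `U · θ^ℕ` is `Φ`-invariant iff it lies in the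
split monoid `U^Φ · θ^ℕ` over the `Φ`-fixed subgroup `U^Φ = U ⊓ ⨅_{φ ∈ Φ} Fix(φ)`. [cite: Mochizuki2012, Def 3.8 (ii) p.113] -/
theorem mem_splitMonoid_and_fixed_iff (hθ : ∀ φ ∈ Φ, φ θ = θ) (x : H) :
    (x ∈ splitMonoid U (Submonoid.powers θ) ∧ ∀ φ ∈ Φ, φ x = x) ↔
      x ∈ splitMonoid (U ⊓ ⨅ φ ∈ Φ, MonoidHom.eqLocus φ.toMonoidHom (MonoidHom.id H)) (Submonoid.powers θ) := by
  constructor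
  · rintro ⟨hx, hfix⟩
    obtain ⟨u, hu, _, ⟨n, rfl⟩, rfl⟩ := (mem_splitMonoid_iff _ _ _).mp hx
    refine (mem_splitMonoid_iff _ _ _).mpr ⟨u, ?_, θ ^ n, ⟨n, rfl⟩, rfl⟩
    refine Subgroup.mem_inf.mpr ⟨hu, ?_⟩
    refine Subgroup.mem_iInf.mpr fun φ => Subgroup.mem_iInf.mpr fun hφ => ?_
    change φ u = u
    have h1 : φ (u * θ ^ n) = u * θ ^ n := hfix φ hφ
    rw [map_mul, map_pow, hθ φ hφ] at h1
    exact mul_right_cancel h1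
  · intro hx
    obtain ⟨u, hu, _, ⟨n, rfl⟩, rfl⟩ := (mem_splitMonoid_iff _ _ _).mp hx
    obtain ⟨huU, hufix⟩ := Subgroup.mem_inf.mp hu
    refine ⟨(mem_splitMonoid_iff _ _ _).mpr ⟨u, huU, θ ^ n, ⟨n, rfl⟩, rfl⟩, fun φ hφ => ?_⟩
    have hφu : φ u = u := by
      have := Subgroup.mem_iInf.mp (Subgroup.mem_iInf.mp hufix φ) hφ
      exact this
    rw [map_mul, map_pow, hθ φ hφ, hφu]

/-- **IUTchII:Def3.8(ii)** (kurims p.113–114): `θ` of infinite order modulo `U` stays of infinite order modulo the fixed subgroup `U^Φ`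
(bookkeeping). [cite: Mochizuki2012, Def 3.8 (ii) p.113] -/
theorem pow_mem_fixed_imp_of_hfree (hfree : ∀ n : ℕ, θ ^ n ∈ U → n = 0) (n : ℕ)
    (hn : θ ^ n ∈ U ⊓ ⨅ φ ∈ Φ, MonoidHom.eqLocus φ.toMonoidHom (MonoidHom.id H)) : n = 0 :=
  hfree n (Subgroup.mem_inf.mp hn).1

/-- **IUTchII:Def3.8(ii)** (kurims p.113 l.76 – p.114 l.1 «whose divisor monoid associates to every object of `B^temp(G_v(−))⁰` …
a monoid isomorphic to `ℕ`»), monoid-level shadow AT EVERY OBJECT: for every family `Φ` of automorphisms fixing the generator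
`θ` (the image of an open subgroup of `G_v(−)`), the divisor monoid ([FrdI] §0 `M^char`, Mathlib `Associates`) of the
`Φ`-invariant split monoid `U^Φ · θ^ℕ` — by `mem_splitMonoid_and_fixed_iff` exactly the `Φ`-invariants of `U · θ^ℕ` — is
`(ℕ, +)`, the class of `u · θ^n` going to `n` (p446426's `exists_associates_splitMonoid_equiv_nat` over `U^Φ`).
[cite: Mochizuki2012, Def 3.8 (ii) p.113] -/
theorem exists_associates_fixed_splitMonoid_equiv_nat (hfree : ∀ n : ℕ, θ ^ n ∈ U → n = 0) :
    ∃ d : Associates (splitMonoid (U ⊓ ⨅ φ ∈ Φ, MonoidHom.eqLocus φ.toMonoidHom (MonoidHom.id H))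
        (Submonoid.powers θ)) ≃* Multiplicative ℕ,
      ∀ (u : H) (hu : u ∈ U ⊓ ⨅ φ ∈ Φ, MonoidHom.eqLocus φ.toMonoidHom (MonoidHom.id H)) (n : ℕ),
        d (Associates.mk ⟨u * θ ^ n, mul_pow_mem_thetaSplit _ θ hu n⟩) = Multiplicative.ofAdd n :=
  exists_associates_splitMonoid_equiv_nat _ θ (pow_mem_fixed_imp_of_hfree U θ Φ hfree)

/-- **IUTchII:Def3.8(ii)** (kurims p.113–114), restriction maps of the divisor functor: for families `Φ ⊆ Φ'` of automorphisms
(an inclusion of open subgroups `K' ≤ K` read through their images — a morphism of connected objects of `B^temp(G_v(−))⁰`), the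
`Φ'`-invariant split monoid is contained in the `Φ`-invariant one, and the inclusion carries the generator `θ` to `θ`: on
divisor monoids `ℕ → ℕ` it is the identity — «monoid type `ℤ`», no ramification in the `θ`-direction.
[cite: Mochizuki2012, Def 3.8 (ii) p.113] -/
theorem fixed_splitMonoid_mono {Φ Φ' : Set (H ≃* H)} (h : Φ ⊆ Φ') :
    splitMonoid (U ⊓ ⨅ φ ∈ Φ', MonoidHom.eqLocus φ.toMonoidHom (MonoidHom.id H)) (Submonoid.powers θ) ≤
      splitMonoid (U ⊓ ⨅ φ ∈ Φ, MonoidHom.eqLocus φ.toMonoidHom (MonoidHom.id H)) (Submonoid.powers θ) := by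
  refine sup_le_sup_right (Subgroup.toSubmonoid_le.mpr (inf_le_inf_left U ?_)) _
  exact iInf_le_iInf_of_subset h |>.trans le_rfl

end Invariants

end TemperedThetaMonoids

end Literature.IUT.HodgeArakelov
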